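import Literature.Computability.Cryptography.WordRAMBlocks
import Literature.Computability.Cryptography.WordRAMBounds
import HarnessLib

/-!
# The word RAM — emulating one word RAM inside another (relocated memory, stamped cells, emulated word size)

The compiler behind the inline simulations of fine-grained complexity (V. Vassilevska Williams,
ICM 2018, §2, the remark after Def. 2.1 — "if `B` has a truly sub-`b` algorithm then `A` has a
truly sub-`a` one" — and Prop. 2.2): a *source* program `M` run at word size `ws` is emulated by
straight-line/jump code inside a *target* program run at a larger word size `W ≥ ws`, with

* **relocated, stamped memory**: source cell `a` is held in target cell `Bv + a`, and is *valid*
  only if its stamp, target cell `Sv + a`, equals the current generation `Gv`; invalid cells read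
  as `0` (`edec`). Bumping the generation therefore clears the emulated memory in one step, which
  is how one scratch region serves all oracle calls of a reduction;
* **emulated word size**: the modulus `2 ^ ws` sits in a register and every reducing operation is
  followed by `mod` (`earith`); since `2 ^ ws ∣ 2 ^ W`, no overflow side condition arises
  (`(z % 2 ^ W) % 2 ^ ws = z % 2 ^ ws`), and `sub` is emulated by `y % P; x + P; x - y; % P`;
* a **layout** (`Layout`) of seven registers (base, stamp base, generation, modulus, three
  temporaries) and a runtime **environment** (`Env`) of their values; `EnvOK` collects the static
  side conditions (registers below both regions, regions disjoint and inside the address space);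
* micro-code `erdAt`/`erd` (emulated operand read), `ewrAt`/`ewr` (emulated write), `earith`,
  `eop` (a whole three-address instruction) with their semantics (`execOps_erd`, `execOps_eop`, …);
* the block compiler `blk`/`compile` with block starts `bstart` (jump targets are translated block
  starts; targets past the end, `halt` and `rand` go to the exit `bstart M base |M|`; `query` is
  compiled by a caller-supplied block `qb` of fixed length), the code-placement lemma
  `codeAt_blk`, the simulation relation `ERel`, the one-step theorem `emu_step` and the run
  theorem `emu_run` for oracle-free deterministic sources.

## References

* V. Vassilevska Williams, *On some fine-grained questions in algorithms and complexity*,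
  Proc. ICM 2018, §2 (word RAM; Def. 2.1 and the remark following it; Prop. 2.2).
* T. Hagerup, *Sorting and searching on the word RAM*, STACS 1998, §2 (the machine model).
-/

namespace Literature.Computability.Cryptography.WordRAM

open StateTransition

/-! ## Layouts and environments -/

/-- The register layout of an emulation: the registers holding the base address of the emulated
cells (`rB`), the base address of their stamps (`rS`), the current generation (`rGen`), the
modulus `2 ^ ws` of the emulated word size (`rP`), and three temporaries. [folklore] -/
structure Layout where
  /-- Register holding the base address `Bv` of the emulated cells. -/
  rB : ℕ
  /-- Register holding the base address `Sv` of the stamps. -/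
  rS : ℕ
  /-- Register holding the current generation `Gv`. -/
  rGen : ℕ
  /-- Register holding the modulus `2 ^ ws`. -/
  rP : ℕ
  /-- First temporary (value of the first operand, result). -/
  t1 : ℕ
  /-- Second temporary (value of the second operand, write address). -/
  t2 : ℕ
  /-- Address temporary. -/
  ta : ℕ
  deriving DecidableEq

/-- The seven registers of a layout, as a list. [folklore] -/
def Layout.regs (L : Layout) : List ℕ :=
  [L.rB, L.rS, L.rGen, L.rP, L.t1, L.t2, L.ta]

/-- The runtime environment of an emulation: base of the cells `Bv`, base of the stamps `Sv`,
current generation `Gv`, emulated word size `ws`, and the size `Q` of each region. [folklore] -/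
structure Env where
  /-- Base address of the emulated cells. -/
  Bv : ℕ
  /-- Base address of the stamps. -/
  Sv : ℕ
  /-- Current generation. -/
  Gv : ℕ
  /-- Emulated word size. -/
  ws : ℕ
  /-- Size of the cell region and of the stamp region. -/
  Q : ℕ

/-- **The emulated memory.** Source cell `a` reads as target cell `Bv + a` if its stamp
`Sv + a` equals the current generation, and as `0` otherwise. [folklore] -/
def edec (E : Env) (mem : ℕ → ℕ) (a : ℕ) : ℕ :=
  if mem (E.Sv + a) = E.Gv then mem (E.Bv + a) else 0

/-- The layout's registers hold the environment's values. [folklore] -/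
def EnvHolds (L : Layout) (E : Env) (mem : ℕ → ℕ) : Prop :=
  mem L.rB = E.Bv ∧ mem L.rS = E.Sv ∧ mem L.rGen = E.Gv ∧ mem L.rP = 2 ^ E.ws

/-- All stamps of the region are at most the current generation (so that bumping the generation
invalidates every cell). [folklore] -/
def StampLE (E : Env) (mem : ℕ → ℕ) : Prop :=
  ∀ a, a < E.Q → mem (E.Sv + a) ≤ E.Gv

/-- Static side conditions of an emulation at target word size `W`: the temporaries are pairwise
distinct and distinct from the four environment registers, all registers lie below both regions,
the two regions are disjoint and fit below `2 ^ W` (so address arithmetic is exact), and the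
emulated word size is at most `W` (so `2 ^ ws ∣ 2 ^ W`). [folklore] -/
structure EnvOK (L : Layout) (E : Env) (W : ℕ) : Prop where
  t1_ne_t2 : L.t1 ≠ L.t2
  t1_ne_ta : L.t1 ≠ L.ta
  t2_ne_ta : L.t2 ≠ L.ta
  rB_ne : L.rB ≠ L.t1 ∧ L.rB ≠ L.t2 ∧ L.rB ≠ L.ta
  rS_ne : L.rS ≠ L.t1 ∧ L.rS ≠ L.t2 ∧ L.rS ≠ L.ta
  rGen_ne : L.rGen ≠ L.t1 ∧ L.rGen ≠ L.t2 ∧ L.rGen ≠ L.ta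
  rP_ne : L.rP ≠ L.t1 ∧ L.rP ≠ L.t2 ∧ L.rP ≠ L.ta
  regs_lt : ∀ r ∈ L.regs, r < E.Bv ∧ r < E.Sv
  disj : E.Bv + E.Q ≤ E.Sv ∨ E.Sv + E.Q ≤ E.Bv
  fitB : E.Bv + E.Q ≤ 2 ^ W
  fitS : E.Sv + E.Q ≤ 2 ^ W
  ws_le : E.ws ≤ W

/-- The footprint of the emulator: the three temporaries and the two regions. Everything the
emulator writes lies in the footprint. [folklore] -/
def Foot (L : Layout) (E : Env) (c : ℕ) : Prop :=
  c = L.t1 ∨ c = L.t2 ∨ c = L.ta ∨ (E.Bv ≤ c ∧ c < E.Bv + E.Q) ∨ (E.Sv ≤ c ∧ c < E.Sv + E.Q)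

section basic

variable {L : Layout} {E : Env} {W : ℕ}

/-- The first temporary lies below both regions. [folklore] -/
theorem EnvOK.t1_lt (h : EnvOK L E W) : L.t1 < E.Bv ∧ L.t1 < E.Sv := h.regs_lt _ (by simp [Layout.regs])
/-- The second temporary lies below both regions. [folklore] -/
theorem EnvOK.t2_lt (h : EnvOK L E W) : L.t2 < E.Bv ∧ L.t2 < E.Sv := h.regs_lt _ (by simp [Layout.regs])
/-- The address temporary lies below both regions. [folklore] -/
theorem EnvOK.ta_lt (h : EnvOK L E W) : L.ta < E.Bv ∧ L.ta < E.Sv := h.regs_lt _ (by simp [Layout.regs])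
/-- The base register lies below both regions. [folklore] -/
theorem EnvOK.rB_lt (h : EnvOK L E W) : L.rB < E.Bv ∧ L.rB < E.Sv := h.regs_lt _ (by simp [Layout.regs])
/-- The stamp-base register lies below both regions. [folklore] -/
theorem EnvOK.rS_lt (h : EnvOK L E W) : L.rS < E.Bv ∧ L.rS < E.Sv := h.regs_lt _ (by simp [Layout.regs])
/-- The generation register lies below both regions. [folklore] -/
theorem EnvOK.rGen_lt (h : EnvOK L E W) : L.rGen < E.Bv ∧ L.rGen < E.Sv := h.regs_lt _ (by simp [Layout.regs])
/-- The modulus register lies below both regions. [folklore] -/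
theorem EnvOK.rP_lt (h : EnvOK L E W) : L.rP < E.Bv ∧ L.rP < E.Sv := h.regs_lt _ (by simp [Layout.regs])

/-- The environment registers are outside the footprint. [folklore] -/
theorem EnvOK.not_foot_rB (h : EnvOK L E W) : ¬ Foot L E L.rB := by
  have := h.rB_ne; have := h.rB_lt; unfold Foot; omega
/-- The stamp-base register is outside the footprint. [folklore] -/
theorem EnvOK.not_foot_rS (h : EnvOK L E W) : ¬ Foot L E L.rS := by
  have := h.rS_ne; have := h.rS_lt; unfold Foot; omega
/-- The generation register is outside the footprint. [folklore] -/
theorem EnvOK.not_foot_rGen (h : EnvOK L E W) : ¬ Foot L E L.rGen := by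
  have := h.rGen_ne; have := h.rGen_lt; unfold Foot; omega
/-- The modulus register is outside the footprint. [folklore] -/
theorem EnvOK.not_foot_rP (h : EnvOK L E W) : ¬ Foot L E L.rP := by
  have := h.rP_ne; have := h.rP_lt; unfold Foot; omega

/-- `EnvHolds` only depends on the environment registers, which are outside the footprint. [folklore] -/
theorem EnvHolds.of_frame (hOK : EnvOK L E W) {mem mem' : ℕ → ℕ} (h : EnvHolds L E mem)
    (hf : ∀ c, ¬ Foot L E c → mem' c = mem c) : EnvHolds L E mem' := by
  obtain ⟨h1, h2, h3, h4⟩ := h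
  exact ⟨by rw [hf _ hOK.not_foot_rB, h1], by rw [hf _ hOK.not_foot_rS, h2],
    by rw [hf _ hOK.not_foot_rGen, h3], by rw [hf _ hOK.not_foot_rP, h4]⟩

/-- `edec` at `a < Q` only depends on the two region cells of `a`. [folklore] -/
theorem edec_congr {mem mem' : ℕ → ℕ} {a : ℕ} (hS : mem' (E.Sv + a) = mem (E.Sv + a))
    (hB : mem' (E.Bv + a) = mem (E.Bv + a)) : edec E mem' a = edec E mem a := by
  simp only [edec, hS, hB]

/-- The emulated value is the cell value or `0`; in particular it is bounded by the cell. [folklore] -/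
theorem edec_le (mem : ℕ → ℕ) (a : ℕ) : edec E mem a ≤ mem (E.Bv + a) := by
  unfold edec; split_ifs <;> omega

/-- The modulus of the emulated word size divides the target modulus. [folklore] -/
theorem EnvOK.pow_dvd (h : EnvOK L E W) : 2 ^ E.ws ∣ 2 ^ W := Nat.pow_dvd_pow 2 h.ws_le

end basic

/-! ## Micro-code: emulated reads and writes -/

/-- Read the emulated cell whose address is given by `src` (an immediate or a register) into
register `T`: `ta := Bv + a; T := Sv + a; T := mem[T]; T := (T = Gv); ta := mem[ta]; T := T * ta`.
Six operations. [folklore] -/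
def erdAt (L : Layout) (src : Operand) (T : ℕ) : List OpSpec :=
  [(.add, .dir L.ta, src, .dir L.rB), (.add, .dir T, src, .dir L.rS), (.div, .dir T, .ind T, .imm 1),
   (.eq, .dir T, .dir T, .dir L.rGen), (.div, .dir L.ta, .ind L.ta, .imm 1),
   (.mul, .dir T, .dir T, .dir L.ta)]

/-- Write register `Tv` to the emulated cell whose address is given by `dst` (an immediate or a
register), stamping it with the current generation:
`ta := Bv + a; mem[ta] := Tv; ta := Sv + a; mem[ta] := Gv`. Four operations. [folklore] -/
def ewrAt (L : Layout) (dst : Operand) (Tv : ℕ) : List OpSpec :=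
  [(.add, .dir L.ta, dst, .dir L.rB), (.div, .ind L.ta, .dir Tv, .imm 1),
   (.add, .dir L.ta, dst, .dir L.rS), (.div, .ind L.ta, .dir L.rGen, .imm 1)]

/-- Emulated read of a source operand into register `T` (`imm`: one move; `dir a`: `erdAt`;
`ind a`: two `erdAt`s, the second addressed by the first's result). [folklore] -/
def erd (L : Layout) : Operand → ℕ → List OpSpec
  | .imm c, T => [(.div, .dir T, .imm c, .imm 1)]
  | .dir a, T => erdAt L (.imm a) T
  | .ind a, T => erdAt L (.imm a) T ++ erdAt L (.dir T) T

/-- Emulated write of register `L.t1` to a source destination operand (`imm`: no-op, as in the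
source semantics; `dir a`: `ewrAt`; `ind a`: read the address into `t2`, then `ewrAt`). [folklore] -/
def ewr (L : Layout) : Operand → List OpSpec
  | .imm _ => []
  | .dir a => ewrAt L (.imm a) L.t1
  | .ind a => erdAt L (.imm a) L.t2 ++ ewrAt L (.dir L.t2) L.t1

/-- `o.IsReduced`: the operation's result is reduced modulo the word size in `BinOp.eval`
(`add sub mul bor bxor shl`); the others (`div mod band shr lt eq`) are word-size independent. [folklore] -/
def BinOp.IsReduced : BinOp → Bool
  | .add | .sub | .mul | .bor | .bxor | .shl => true
  | _ => false

/-- Emulated arithmetic `t1 := o (t1) (t2)` at the emulated word size (modulus in `rP`):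
`sub` becomes `t2 %= P; t1 += P; t1 -= t2; t1 %= P`; the other reduced operations are followed by
`t1 %= P`; the word-size independent ones are executed natively. [folklore] -/
def earith (L : Layout) : BinOp → List OpSpec
  | .sub => [(.mod, .dir L.t2, .dir L.t2, .dir L.rP), (.add, .dir L.t1, .dir L.t1, .dir L.rP),
      (.sub, .dir L.t1, .dir L.t1, .dir L.t2), (.mod, .dir L.t1, .dir L.t1, .dir L.rP)]
  | o => if o.IsReduced then [(o, .dir L.t1, .dir L.t1, .dir L.t2), (.mod, .dir L.t1, .dir L.t1, .dir L.rP)]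
      else [(o, .dir L.t1, .dir L.t1, .dir L.t2)]

/-- The emulation of the source instruction `op o dst x y`. [folklore] -/
def eop (L : Layout) (o : BinOp) (dst x y : Operand) : List OpSpec :=
  erd L x L.t1 ++ erd L y L.t2 ++ earith L o ++ ewr L dst

/-! ## Semantics of the micro-code -/

section micro

variable {L : Layout} {E : Env} {W : ℕ}

/-- One operation writing a register. [folklore] -/
theorem execOp_dir (w : ℕ) (mem : ℕ → ℕ) (o : BinOp) (T : ℕ) (x y : Operand) :
    execOp w mem (o, .dir T, x, y) = Function.update mem T (o.eval w (x.read mem) (y.read mem)) := rfl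

/-- One operation writing through a register. [folklore] -/
theorem execOp_ind (w : ℕ) (mem : ℕ → ℕ) (o : BinOp) (T : ℕ) (x y : Operand) :
    execOp w mem (o, .ind T, x, y) =
      Function.update mem (mem T) (o.eval w (x.read mem) (y.read mem)) := rfl

/-- Writing through a direct operand. [folklore] -/
@[simp] theorem Operand.write_dir (mem : ℕ → ℕ) (v a : ℕ) :
    (Operand.dir a).write mem v = Function.update mem a v := rfl

/-- Writing through an indirect operand. [folklore] -/
@[simp] theorem Operand.write_ind (mem : ℕ → ℕ) (v a : ℕ) :
    (Operand.ind a).write mem v = Function.update mem (mem a) v := rfl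

/-- `x / 1 = x`: the exact move. [folklore] -/
@[simp] theorem BinOp.eval_div_one (w x : ℕ) : BinOp.eval w .div x 1 = x := Nat.div_one x

/-- `OperandStable src S`: reading `src` is insensitive to the cells in `S` (used for `imm` sources
and for register sources not among the scratch registers of a micro-routine). [folklore] -/
def OperandStable (src : Operand) (S : ℕ → Prop) : Prop :=
  ∀ (mem : ℕ → ℕ) (c v : ℕ), S c → src.read (Function.update mem c v) = src.read mem

/-- Immediates are stable under any writes. [folklore] -/
theorem operandStable_imm (a : ℕ) (S : ℕ → Prop) : OperandStable (.imm a) S := fun _ _ _ _ => rfl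

/-- A register source is stable under writes to other cells. [folklore] -/
theorem operandStable_dir {r : ℕ} {S : ℕ → Prop} (h : ∀ c, S c → c ≠ r) : OperandStable (.dir r) S :=
  fun mem c v hc => by simp [Function.update_of_ne (h c hc).symm]

/-- **Semantics of `erdAt`.** With the environment in place, reading the emulated cell at address
`a = src.read mem < Q` puts `edec E mem a` into `T` and changes nothing outside `{T, ta}`. [folklore] -/
theorem execOps_erdAt (hOK : EnvOK L E W) {mem : ℕ → ℕ} (henv : EnvHolds L E mem)
    {VT : ℕ} (hVT : VT + 1 = 2 ^ W) (hmem : MemLE VT mem) {src : Operand} {T : ℕ}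
    (hsrc : OperandStable src fun c => c = L.ta)
    (hT : T ≠ L.ta ∧ T ≠ L.rB ∧ T ≠ L.rS ∧ T ≠ L.rGen) (hTlt : T < E.Bv ∧ T < E.Sv)
    (ha : src.read mem < E.Q) :
    (execOps W mem (erdAt L src T)) T = edec E mem (src.read mem) ∧
      ∀ c, c ≠ T → c ≠ L.ta → (execOps W mem (erdAt L src T)) c = mem c := by
  obtain ⟨hB, hS, hG, -⟩ := henv
  have hta := hOK.ta_lt
  have hrB := hOK.rB_ne; have hrS := hOK.rS_ne; have hrG := hOK.rGen_ne
  have hfitB := hOK.fitB; have hfitS := hOK.fitS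
  set a := src.read mem with ha_def
  have hW1 : 1 ≤ 2 ^ W := Nat.one_le_two_pow
  -- step 1: ta := Bv + a
  set m1 := execOp W mem (.add, .dir L.ta, src, .dir L.rB) with hm1
  have hm1v : m1 = Function.update mem L.ta (E.Bv + a) := by
    rw [hm1, execOp_dir]
    congr 1
    simp only [BinOp.eval, Operand.read_dir, hB, ← ha_def]
    rw [Nat.mod_eq_of_lt (by omega)]
    omega
  -- step 2: T := Sv + a
  set m2 := execOp W m1 (.add, .dir T, src, .dir L.rS) with hm2
  have hsrc1 : src.read m1 = a := by rw [hm1v, hsrc mem L.ta _ rfl]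
  have hm2v : m2 = Function.update m1 T (E.Sv + a) := by
    rw [hm2, execOp_dir]
    congr 1
    simp only [BinOp.eval, Operand.read_dir, hsrc1]
    rw [hm1v, Function.update_of_ne hrS.2.2, hS, Nat.mod_eq_of_lt (by omega)]
    omega
  -- step 3: T := mem[T] = stamp
  set m3 := execOp W m2 (.div, .dir T, .ind T, .imm 1) with hm3
  have h2T : m2 T = E.Sv + a := by rw [hm2v, Function.update_self]
  have h2S : m2 (E.Sv + a) = mem (E.Sv + a) := by
    rw [hm2v, Function.update_of_ne (by omega), hm1v, Function.update_of_ne (by omega)]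
  have hm3v : m3 = Function.update m2 T (mem (E.Sv + a)) := by
    rw [hm3, execOp_dir]
    congr 1
    simp only [Operand.read_ind, Operand.read_imm, BinOp.eval_div_one, h2T, h2S]
  -- step 4: T := (stamp = Gv)
  set m4 := execOp W m3 (.eq, .dir T, .dir T, .dir L.rGen) with hm4
  have h3T : m3 T = mem (E.Sv + a) := by rw [hm3v, Function.update_self]
  have h3G : m3 L.rGen = E.Gv := by
    rw [hm3v, Function.update_of_ne hT.2.2.2.symm, hm2v, Function.update_of_ne hT.2.2.2.symm, hm1v,
      Function.update_of_ne hrG.2.2, hG]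
  have hm4v : m4 = Function.update m3 T (if mem (E.Sv + a) = E.Gv then 1 else 0) := by
    rw [hm4, execOp_dir]
    congr 1
    simp only [BinOp.eval, Operand.read_dir, h3T, h3G]
  -- step 5: ta := mem[ta] = cell
  set m5 := execOp W m4 (.div, .dir L.ta, .ind L.ta, .imm 1) with hm5
  have hta4 : m4 L.ta = E.Bv + a := by
    rw [hm4v, Function.update_of_ne (Ne.symm hT.1), hm3v, Function.update_of_ne (Ne.symm hT.1),
      hm2v, Function.update_of_ne (Ne.symm hT.1), hm1v, Function.update_self]
  have h4B : m4 (E.Bv + a) = mem (E.Bv + a) := by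
    rw [hm4v, Function.update_of_ne (by omega), hm3v, Function.update_of_ne (by omega), hm2v,
      Function.update_of_ne (by omega), hm1v, Function.update_of_ne (by omega)]
  have hm5v : m5 = Function.update m4 L.ta (mem (E.Bv + a)) := by
    rw [hm5, execOp_dir]
    congr 1
    simp only [Operand.read_ind, Operand.read_imm, BinOp.eval_div_one, hta4, h4B]
  -- step 6: T := T * ta
  set m6 := execOp W m5 (.mul, .dir T, .dir T, .dir L.ta) with hm6
  have hT5 : m5 T = if mem (E.Sv + a) = E.Gv then 1 else 0 := by
    rw [hm5v, Function.update_of_ne hT.1, hm4v, Function.update_self]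
  have hta5 : m5 L.ta = mem (E.Bv + a) := by rw [hm5v, Function.update_self]
  have hcell : mem (E.Bv + a) < 2 ^ W := by have := hmem (E.Bv + a); rw [← hVT]; omega
  have hm6v : m6 = Function.update m5 T (edec E mem a) := by
    rw [hm6, execOp_dir]
    congr 1
    simp only [BinOp.eval, Operand.read_dir, hT5, hta5, edec]
    split_ifs <;> simp [Nat.mod_eq_of_lt hcell]
  have hexec : execOps W mem (erdAt L src T) = m6 := rfl
  rw [hexec]
  refine ⟨by rw [hm6v, Function.update_self], fun c hcT hcta => ?_⟩
  rw [hm6v, Function.update_of_ne hcT, hm5v, Function.update_of_ne hcta, hm4v,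
    Function.update_of_ne hcT, hm3v, Function.update_of_ne hcT, hm2v, Function.update_of_ne hcT,
    hm1v, Function.update_of_ne hcta]

/-- The constants of an operation. [folklore] -/
def OpSpec.maxConst (s : OpSpec) : ℕ := (OpSpec.toInstr s).maxConst

/-- `1 ≤ 2 ^ W - 1` for `W ≥ 1`. [folklore] -/
theorem one_le_two_pow_sub_one {W : ℕ} (hW : 1 ≤ W) : 1 ≤ 2 ^ W - 1 := by
  have : 2 ≤ 2 ^ W := by
    calc (2 : ℕ) = 2 ^ 1 := by norm_num
      _ ≤ 2 ^ W := Nat.pow_le_pow_right (by norm_num) hW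
  omega

/-- The constants of `erdAt` are its registers, the source's constant and `1`. [folklore] -/
theorem erdAt_maxConst (L : Layout) (src : Operand) (T : ℕ) {V : ℕ} (hsrc : src.const ≤ V)
    (hT : T ≤ V) (hta : L.ta ≤ V) (hrB : L.rB ≤ V) (hrS : L.rS ≤ V) (hrG : L.rGen ≤ V)
    (h1 : 1 ≤ V) : ∀ s ∈ erdAt L src T, s.maxConst ≤ V := by
  intro s hs
  simp only [erdAt, List.mem_cons, List.mem_nil_iff, or_false] at hs
  rcases hs with rfl | rfl | rfl | rfl | rfl | rfl <;>
    simp only [OpSpec.maxConst, OpSpec.toInstr, Instr.maxConst, Operand.const_imm,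
      Operand.const_dir, Operand.const_ind, max_le_iff] <;> omega

/-- The constants of `ewrAt` are its registers, the destination's constant and `1`. [folklore] -/
theorem ewrAt_maxConst (L : Layout) (dst : Operand) (Tv : ℕ) {V : ℕ} (hdst : dst.const ≤ V)
    (hTv : Tv ≤ V) (hta : L.ta ≤ V) (hrB : L.rB ≤ V) (hrS : L.rS ≤ V) (hrG : L.rGen ≤ V)
    (h1 : 1 ≤ V) : ∀ s ∈ ewrAt L dst Tv, s.maxConst ≤ V := by
  intro s hs
  simp only [ewrAt, List.mem_cons, List.mem_nil_iff, or_false] at hs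
  rcases hs with rfl | rfl | rfl | rfl <;>
    simp only [OpSpec.maxConst, OpSpec.toInstr, Instr.maxConst, Operand.const_imm,
      Operand.const_dir, Operand.const_ind, max_le_iff] <;> omega

/-- Straight-line code preserves a value bound `V ≥ 2 ^ W - 1`, `V ≥ 1`, provided its constants
are `≤ V` (cf. `step_memLE`). [folklore] -/
theorem execOp_memLE {V : ℕ} (hW : 2 ^ W - 1 ≤ V) (h1 : 1 ≤ V) {mem : ℕ → ℕ} (hm : MemLE V mem)
    (s : OpSpec) (hs : s.maxConst ≤ V) : MemLE V (execOp W mem s) := by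
  obtain ⟨o, dst, x, y⟩ := s
  simp only [OpSpec.maxConst, OpSpec.toInstr, Instr.maxConst, max_le_iff] at hs
  exact Operand.write_memLE hm (BinOp.eval_le (Operand.read_le hm x hs.2.1) hW h1 o) dst

/-- Straight-line code preserves a value bound (list version). [folklore] -/
theorem execOps_memLE {V : ℕ} (hW : 2 ^ W - 1 ≤ V) (h1 : 1 ≤ V) :
    ∀ (ops : List OpSpec) {mem : ℕ → ℕ}, MemLE V mem → (∀ s ∈ ops, s.maxConst ≤ V) →
      MemLE V (execOps W mem ops)
  | [], _, hm, _ => hm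
  | s :: ops, _, hm, hs => by
      rw [execOps_cons]
      exact execOps_memLE hW h1 ops (execOp_memLE hW h1 hm s (hs s (by simp)))
        fun s' hs' => hs s' (by simp [hs'])

/-- **Semantics of `ewrAt`.** Writing register `Tv` to the emulated cell at address
`a = dst.read mem < Q`: afterwards cell `Bv + a` holds `mem Tv`, stamp `Sv + a` holds `Gv`, and
nothing else changes except `ta`. [folklore] -/
theorem execOps_ewrAt (hOK : EnvOK L E W) {mem : ℕ → ℕ} (henv : EnvHolds L E mem)
    {dst : Operand} {Tv : ℕ}
    (hdst : OperandStable dst fun c => c = L.ta ∨ E.Bv ≤ c ∨ E.Sv ≤ c)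
    (hTv : Tv ≠ L.ta) (ha : dst.read mem < E.Q) :
    (execOps W mem (ewrAt L dst Tv)) (E.Bv + dst.read mem) = mem Tv ∧
      (execOps W mem (ewrAt L dst Tv)) (E.Sv + dst.read mem) = E.Gv ∧
      ∀ c, c ≠ L.ta → c ≠ E.Bv + dst.read mem → c ≠ E.Sv + dst.read mem →
        (execOps W mem (ewrAt L dst Tv)) c = mem c := by
  obtain ⟨hB, hS, hG, -⟩ := henv
  have hta := hOK.ta_lt
  have hrB := hOK.rB_ne; have hrS := hOK.rS_ne; have hrG := hOK.rGen_ne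
  have hrSlt := hOK.rS_lt; have hrGlt := hOK.rGen_lt
  have hfitB := hOK.fitB; have hfitS := hOK.fitS
  have hdisj := hOK.disj
  set a := dst.read mem with ha_def
  -- step 1: ta := Bv + a
  set m1 := execOp W mem (.add, .dir L.ta, dst, .dir L.rB) with hm1
  have hm1v : m1 = Function.update mem L.ta (E.Bv + a) := by
    rw [hm1, execOp_dir]
    congr 1
    simp only [BinOp.eval, Operand.read_dir, hB, ← ha_def]
    rw [Nat.mod_eq_of_lt (by omega)]
    omega
  -- step 2: mem[ta] := Tv
  set m2 := execOp W m1 (.div, .ind L.ta, .dir Tv, .imm 1) with hm2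
  have hm2v : m2 = Function.update m1 (E.Bv + a) (mem Tv) := by
    rw [hm2, execOp_ind]
    have h1 : m1 L.ta = E.Bv + a := by rw [hm1v, Function.update_self]
    have h2 : m1 Tv = mem Tv := by rw [hm1v, Function.update_of_ne hTv]
    rw [h1]
    congr 1
    simp only [Operand.read_dir, Operand.read_imm, BinOp.eval_div_one, h2]
  -- step 3: ta := Sv + a
  set m3 := execOp W m2 (.add, .dir L.ta, dst, .dir L.rS) with hm3
  have hdst2 : dst.read m2 = a := by
    rw [hm2v, hdst _ _ _ (Or.inr (Or.inl (Nat.le_add_right _ _))), hm1v, hdst _ _ _ (Or.inl rfl)]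
  have hm3v : m3 = Function.update m2 L.ta (E.Sv + a) := by
    rw [hm3, execOp_dir]
    congr 1
    simp only [BinOp.eval, Operand.read_dir, hdst2]
    rw [hm2v, Function.update_of_ne (by omega), hm1v, Function.update_of_ne hrS.2.2, hS,
      Nat.mod_eq_of_lt (by omega)]
    omega
  -- step 4: mem[ta] := Gv
  set m4 := execOp W m3 (.div, .ind L.ta, .dir L.rGen, .imm 1) with hm4
  have hm4v : m4 = Function.update m3 (E.Sv + a) E.Gv := by
    rw [hm4, execOp_ind]
    have h1 : m3 L.ta = E.Sv + a := by rw [hm3v, Function.update_self]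
    have h2 : m3 L.rGen = E.Gv := by
      rw [hm3v, Function.update_of_ne hrG.2.2, hm2v, Function.update_of_ne (by omega), hm1v,
        Function.update_of_ne hrG.2.2, hG]
    rw [h1]
    congr 1
    simp only [Operand.read_dir, Operand.read_imm, BinOp.eval_div_one, h2]
  have hexec : execOps W mem (ewrAt L dst Tv) = m4 := rfl
  rw [hexec]
  have hBS : E.Bv + a ≠ E.Sv + a := by omega
  refine ⟨?_, by rw [hm4v, Function.update_self], fun c h1 h2 h3 => ?_⟩
  · rw [hm4v, Function.update_of_ne hBS, hm3v, Function.update_of_ne (by omega), hm2v,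
      Function.update_self]
  · rw [hm4v, Function.update_of_ne h3, hm3v, Function.update_of_ne h1, hm2v,
      Function.update_of_ne h2, hm1v, Function.update_of_ne h1]
end micro

/-! ## The target-side invariant and operand-level semantics -/

/-- The target-side invariant of an emulation: the environment registers hold the environment,
all stamps are at most the generation, and every cell is at most `VT = 2 ^ W - 1`. [folklore] -/
structure TInv (L : Layout) (E : Env) (VT : ℕ) (mem : ℕ → ℕ) : Prop where
  /-- The layout registers hold the environment. -/
  env : EnvHolds L E mem
  /-- Stamps are bounded by the generation. -/
  stamp : StampLE E mem
  /-- The target value bound. -/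
  memT : MemLE VT mem

/-- The emulated memory agrees with a source memory below `Q`. [folklore] -/
def Agree (E : Env) (mem : ℕ → ℕ) (dmem : ℕ → ℕ) : Prop :=
  ∀ a, a < E.Q → edec E mem a = dmem a

section operands

variable {L : Layout} {E : Env} {W VT : ℕ}

/-- A change confined to cells below both regions preserves agreement and stamps. [folklore] -/
theorem Agree.of_low_frame {mem mem' dmem : ℕ → ℕ} (hag : Agree E mem dmem)
    (hf : ∀ c, E.Bv ≤ c ∨ E.Sv ≤ c → mem' c = mem c) : Agree E mem' dmem := fun a ha => by
  rw [← hag a ha]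
  exact edec_congr (hf _ (Or.inr (Nat.le_add_right _ _))) (hf _ (Or.inl (Nat.le_add_right _ _)))

/-- A change confined to cells below both regions preserves the stamp bound. [folklore] -/
theorem StampLE.of_low_frame {mem mem' : ℕ → ℕ} (hst : StampLE E mem)
    (hf : ∀ c, E.Bv ≤ c ∨ E.Sv ≤ c → mem' c = mem c) : StampLE E mem' := fun a ha => by
  rw [hf _ (Or.inr (Nat.le_add_right _ _))]; exact hst a ha

/-- Updating one register below the regions, other than the environment registers, with a value
`≤ VT` preserves the target invariant and agreement. [folklore] -/
theorem TInv.update_reg (_hOK : EnvOK L E W) {mem : ℕ → ℕ} (hI : TInv L E VT mem) {T v : ℕ}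
    (hT : T ≠ L.rB ∧ T ≠ L.rS ∧ T ≠ L.rGen ∧ T ≠ L.rP) (hTlt : T < E.Bv ∧ T < E.Sv) (hv : v ≤ VT) :
    TInv L E VT (Function.update mem T v) := by
  obtain ⟨⟨h1, h2, h3, h4⟩, hst, hm⟩ := hI
  refine ⟨⟨by rw [Function.update_of_ne hT.1.symm, h1], by rw [Function.update_of_ne hT.2.1.symm, h2],
    by rw [Function.update_of_ne hT.2.2.1.symm, h3], by rw [Function.update_of_ne hT.2.2.2.symm, h4]⟩,
    hst.of_low_frame fun c hc => Function.update_of_ne (by omega) _ _, fun c => ?_⟩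
  rcases eq_or_ne c T with rfl | hc
  · rw [Function.update_self]; exact hv
  · rw [Function.update_of_ne hc]; exact hm c

/-- `erdAt` preserves the target invariant. [folklore] -/
theorem TInv.erdAt (hOK : EnvOK L E W) (hVT : VT + 1 = 2 ^ W) {mem : ℕ → ℕ} (hI : TInv L E VT mem)
    {src : Operand} {T : ℕ} (hsrc : OperandStable src fun c => c = L.ta)
    (hT : T ≠ L.ta ∧ T ≠ L.rB ∧ T ≠ L.rS ∧ T ≠ L.rGen) (hTP : T ≠ L.rP) (hTlt : T < E.Bv ∧ T < E.Sv)
    (ha : src.read mem < E.Q) (hcs : src.const ≤ VT) (h1 : 1 ≤ VT) (hTV : T ≤ VT) :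
    TInv L E VT (execOps W mem (erdAt L src T)) ∧
      (execOps W mem (erdAt L src T)) T = edec E mem (src.read mem) ∧
      ∀ c, c ≠ T → c ≠ L.ta → (execOps W mem (erdAt L src T)) c = mem c := by
  obtain ⟨hv, hf⟩ := execOps_erdAt hOK hI.env hVT hI.memT hsrc hT hTlt ha
  have hta := hOK.ta_lt
  have hrB := hOK.rB_ne; have hrS := hOK.rS_ne; have hrG := hOK.rGen_ne; have hrP := hOK.rP_ne
  have hrBl := hOK.rB_lt; have hrSl := hOK.rS_lt; have hrGl := hOK.rGen_lt
  have hfit := hOK.fitB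
  obtain ⟨⟨e1, e2, e3, e4⟩, hst, hm⟩ := hI
  refine ⟨⟨⟨by rw [hf _ hT.2.1.symm hrB.2.2, e1], by rw [hf _ hT.2.2.1.symm hrS.2.2, e2],
    by rw [hf _ hT.2.2.2.symm hrG.2.2, e3], by rw [hf _ hTP.symm hrP.2.2, e4]⟩,
    hst.of_low_frame fun c hc => hf _ (by omega) (by omega),
    execOps_memLE (by omega) h1 _ hm
      (erdAt_maxConst L src T hcs hTV (by omega) (by omega) (by omega) (by omega) h1)⟩, hv, hf⟩

/-- **Semantics of `erd`.** Reading a source operand `x` (constant `≤ V`) of a `V`-bounded source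
memory that the emulated memory agrees with puts `x.read dmem` into `T`, preserves the target
invariant and agreement, and changes only `T` and `ta`. [folklore] -/
theorem execOps_erd (hOK : EnvOK L E W) (hVT : VT + 1 = 2 ^ W) {mem dmem : ℕ → ℕ}
    (hI : TInv L E VT mem) (hag : Agree E mem dmem) {V : ℕ} (hdm : MemLE V dmem) (hVQ : V < E.Q)
    (hVVT : V ≤ VT) (h1 : 1 ≤ VT) (x : Operand) (hx : x.const ≤ V) {T : ℕ}
    (hT : T ≠ L.ta ∧ T ≠ L.rB ∧ T ≠ L.rS ∧ T ≠ L.rGen) (hTP : T ≠ L.rP) (hTlt : T < E.Bv ∧ T < E.Sv)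
    (hTV : T ≤ VT) :
    TInv L E VT (execOps W mem (erd L x T)) ∧ (execOps W mem (erd L x T)) T = x.read dmem ∧
      Agree E (execOps W mem (erd L x T)) dmem ∧
      ∀ c, c ≠ T → c ≠ L.ta → (execOps W mem (erd L x T)) c = mem c := by
  have hta := hOK.ta_lt
  cases x with
  | imm c =>
    simp only [Operand.const_imm] at hx
    have hexec : execOps W mem (erd L (.imm c) T) = Function.update mem T c := by
      simp only [erd, execOps_cons, execOps_nil, execOp_dir, Operand.read_imm, BinOp.eval_div_one]
    rw [hexec]
    refine ⟨hI.update_reg hOK ⟨hT.2.1, hT.2.2.1, hT.2.2.2, hTP⟩ hTlt (hx.trans hVVT),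
      by rw [Function.update_self]; rfl,
      hag.of_low_frame fun c' hc' => Function.update_of_ne (by omega) _ _,
      fun c' hc' _ => Function.update_of_ne hc' _ _⟩
  | dir a =>
    simp only [Operand.const_dir] at hx
    have haQ : (Operand.imm a).read mem < E.Q := by simp only [Operand.read_imm]; omega
    obtain ⟨hI', hv, hf⟩ := hI.erdAt hOK hVT (operandStable_imm a _) hT hTP hTlt haQ
      (by simp only [Operand.const_imm]; omega) h1 hTV
    refine ⟨hI', ?_, hag.of_low_frame fun c' hc' => hf _ (by omega) (by omega), hf⟩
    rw [show erd L (.dir a) T = erdAt L (.imm a) T from rfl, hv, Operand.read_imm, Operand.read_dir]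
    exact hag a (by omega)
  | ind a =>
    simp only [Operand.const_ind] at hx
    have haQ : (Operand.imm a).read mem < E.Q := by simp only [Operand.read_imm]; omega
    obtain ⟨hI₁, hv₁, hf₁⟩ := hI.erdAt hOK hVT (operandStable_imm a _) hT hTP hTlt haQ
      (by simp only [Operand.const_imm]; omega) h1 hTV
    set m₁ := execOps W mem (erdAt L (.imm a) T) with hm₁
    have hag₁ : Agree E m₁ dmem := hag.of_low_frame fun c' hc' => hf₁ _ (by omega) (by omega)
    have hT₁ : m₁ T = dmem a := by rw [hv₁, Operand.read_imm]; exact hag a (by omega)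
    have haQ₂ : (Operand.dir T).read m₁ < E.Q := by
      rw [Operand.read_dir, hT₁]; exact lt_of_le_of_lt (hdm a) hVQ
    obtain ⟨hI₂, hv₂, hf₂⟩ := hI₁.erdAt hOK hVT (operandStable_dir fun c' hc' => hc' ▸ hT.1.symm)
      hT hTP hTlt haQ₂ (by simp only [Operand.const_dir]; omega) h1 hTV
    have hexec : execOps W mem (erd L (.ind a) T) = execOps W m₁ (erdAt L (.dir T) T) := by
      rw [show erd L (.ind a) T = erdAt L (.imm a) T ++ erdAt L (.dir T) T from rfl, execOps_append]
    rw [hexec]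
    refine ⟨hI₂, ?_, hag₁.of_low_frame fun c' hc' => hf₂ _ (by omega) (by omega),
      fun c' hc' hc'' => by rw [hf₂ _ hc' hc'', hf₁ _ hc' hc'']⟩
    rw [hv₂, Operand.read_dir, hT₁, Operand.read_ind]
    exact hag₁ _ (lt_of_le_of_lt (hdm a) hVQ)

/-- **Semantics of `ewrAt`, invariant form.** Writing the content of register `Tv` (a register
address `≤ VT`, distinct from `ta`; its content is arbitrary) to the emulated cell at
`a = dst.read mem < Q` turns agreement with `dmem` into agreement with
`Function.update dmem a (mem Tv)`, preserves the target invariant, and changes only `ta` and the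
two region cells of `a`. [folklore] -/
theorem execOps_ewrAt_agree (hOK : EnvOK L E W) (hVT : VT + 1 = 2 ^ W) {mem dmem : ℕ → ℕ}
    (hI : TInv L E VT mem) (hag : Agree E mem dmem) {dst : Operand} {Tv : ℕ}
    (hdst : OperandStable dst fun c => c = L.ta ∨ E.Bv ≤ c ∨ E.Sv ≤ c)
    (hTv : Tv ≠ L.ta) (ha : dst.read mem < E.Q) (hcs : dst.const ≤ VT) (hTvV : Tv ≤ VT)
    (h1 : 1 ≤ VT) :
    TInv L E VT (execOps W mem (ewrAt L dst Tv)) ∧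
      Agree E (execOps W mem (ewrAt L dst Tv)) (Function.update dmem (dst.read mem) (mem Tv)) ∧
      ∀ c, c ≠ L.ta → c ≠ E.Bv + dst.read mem → c ≠ E.Sv + dst.read mem →
        (execOps W mem (ewrAt L dst Tv)) c = mem c := by
  obtain ⟨hB, hS, hf⟩ := execOps_ewrAt hOK hI.env hdst hTv ha
  have hta := hOK.ta_lt
  have hrB := hOK.rB_ne; have hrS := hOK.rS_ne; have hrG := hOK.rGen_ne; have hrP := hOK.rP_ne
  have hrBl := hOK.rB_lt; have hrSl := hOK.rS_lt; have hrGl := hOK.rGen_lt; have hrPl := hOK.rP_lt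
  have hfit := hOK.fitB; have hfitS := hOK.fitS; have hdisj := hOK.disj
  obtain ⟨⟨e1, e2, e3, e4⟩, hst, hm⟩ := hI
  set a := dst.read mem
  refine ⟨⟨⟨by rw [hf _ hrB.2.2 (by omega) (by omega), e1], by rw [hf _ hrS.2.2 (by omega) (by omega), e2],
      by rw [hf _ hrG.2.2 (by omega) (by omega), e3], by rw [hf _ hrP.2.2 (by omega) (by omega), e4]⟩,
      fun a' ha' => ?_, ?_⟩, fun a' ha' => ?_, hf⟩
  · -- stamps
    rcases eq_or_ne a' a with rfl | hne
    · rw [hS]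
    · rw [hf _ (by omega) (by omega) (by omega)]; exact hst a' ha'
  · -- target bound
    exact execOps_memLE (by omega) h1 _ hm
      (ewrAt_maxConst L dst Tv hcs hTvV (by omega) (by omega) (by omega) (by omega) h1)
  · -- agreement
    rcases eq_or_ne a' a with rfl | hne
    · rw [Function.update_self, edec, if_pos hS, hB]
    · rw [Function.update_of_ne hne, ← hag a' ha']
      exact edec_congr (hf _ (by omega) (by omega) (by omega)) (hf _ (by omega) (by omega) (by omega))

/-- **Semantics of `ewr`.** Emulated write of register `t1` through the source destination
operand `dst` (constant `≤ V`): agreement with `dmem` becomes agreement with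
`dst.write dmem (mem t1)`; the target invariant is preserved; `t1` is unchanged; only `t2`, `ta`
and region cells change. [folklore] -/
theorem execOps_ewr (hOK : EnvOK L E W) (hVT : VT + 1 = 2 ^ W) {mem dmem : ℕ → ℕ}
    (hI : TInv L E VT mem) (hag : Agree E mem dmem) {V : ℕ} (hdm : MemLE V dmem) (hVQ : V < E.Q)
    (hVVT : V ≤ VT) (h1 : 1 ≤ VT) (ht1V : L.t1 ≤ VT) (ht2V : L.t2 ≤ VT) (dst : Operand)
    (hx : dst.const ≤ V) :
    TInv L E VT (execOps W mem (ewr L dst)) ∧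
      Agree E (execOps W mem (ewr L dst)) (dst.write dmem (mem L.t1)) ∧
      (execOps W mem (ewr L dst)) L.t1 = mem L.t1 ∧
      ∀ c, c ≠ L.t2 → c ≠ L.ta → ¬ (E.Bv ≤ c ∧ c < E.Bv + E.Q) → ¬ (E.Sv ≤ c ∧ c < E.Sv + E.Q) →
        (execOps W mem (ewr L dst)) c = mem c := by
  have hta := hOK.ta_lt; have ht1 := hOK.t1_lt; have ht2 := hOK.t2_lt
  have h12 := hOK.t1_ne_t2; have h1a := hOK.t1_ne_ta; have h2a := hOK.t2_ne_ta
  cases dst with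
  | imm c =>
    have hexec : execOps W mem (ewr L (.imm c)) = mem := rfl
    rw [hexec]
    exact ⟨hI, hag, rfl, fun _ _ _ _ _ => rfl⟩
  | dir a =>
    simp only [Operand.const_dir] at hx
    have hexec : execOps W mem (ewr L (.dir a)) = execOps W mem (ewrAt L (.imm a) L.t1) := rfl
    have haQ' : a < E.Q := by omega
    have haQ : (Operand.imm a).read mem < E.Q := by simpa only [Operand.read_imm] using haQ'
    obtain ⟨hI', hag', hf⟩ := execOps_ewrAt_agree hOK hVT hI hag (operandStable_imm a _)
      h1a haQ (by simp only [Operand.const_imm]; omega) ht1V h1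
    rw [hexec]
    simp only [Operand.read_imm] at hf
    refine ⟨hI', by simpa only [Operand.read_imm, Operand.write_dir] using hag', hf _ h1a (by omega) (by omega),
      fun c' _ hc' hcB hcS => hf _ hc' (by omega) (by omega)⟩
  | ind a =>
    simp only [Operand.const_ind] at hx
    have hexec : execOps W mem (ewr L (.ind a)) =
        execOps W (execOps W mem (erdAt L (.imm a) L.t2)) (ewrAt L (.dir L.t2) L.t1) := by
      rw [show ewr L (.ind a) = erdAt L (.imm a) L.t2 ++ ewrAt L (.dir L.t2) L.t1 from rfl,
        execOps_append]
    have haQ : (Operand.imm a).read mem < E.Q := by simp only [Operand.read_imm]; omega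
    have hrB := hOK.rB_ne; have hrS := hOK.rS_ne; have hrG := hOK.rGen_ne; have hrP := hOK.rP_ne
    obtain ⟨hI₁, hv₁, hf₁⟩ := hI.erdAt hOK hVT (operandStable_imm a _)
      ⟨h2a, hrB.2.1.symm, hrS.2.1.symm, hrG.2.1.symm⟩ hrP.2.1.symm ht2 haQ
      (by simp only [Operand.const_imm]; omega) h1 ht2V
    set m₁ := execOps W mem (erdAt L (.imm a) L.t2) with hm₁
    have hag₁ : Agree E m₁ dmem := hag.of_low_frame fun c' hc' => hf₁ _ (by omega) (by omega)
    have ht2₁ : m₁ L.t2 = dmem a := by rw [hv₁, Operand.read_imm]; exact hag a (by omega)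
    have ht1₁ : m₁ L.t1 = mem L.t1 := hf₁ _ h12 h1a
    have haQ₂ : (Operand.dir L.t2).read m₁ < E.Q := by
      rw [Operand.read_dir, ht2₁]; exact lt_of_le_of_lt (hdm a) hVQ
    obtain ⟨hI₂, hag₂, hf₂⟩ := execOps_ewrAt_agree hOK hVT hI₁ hag₁
      (operandStable_dir fun c' hc' => by rcases hc' with rfl | hc' | hc' <;> omega)
      h1a haQ₂ (by simp only [Operand.const_dir]; omega) ht1V h1
    rw [hexec]
    have hdlt : dmem a < E.Q := lt_of_le_of_lt (hdm a) hVQ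
    simp only [Operand.read_dir, ht2₁] at hf₂
    refine ⟨hI₂, ?_, ?_, fun c' hc2 hc' hcB hcS => ?_⟩
    · rw [Operand.read_dir, ht2₁, ht1₁] at hag₂
      simpa only [Operand.write_ind] using hag₂
    · rw [hf₂ _ h1a (by omega) (by omega), ht1₁]
    · rw [hf₂ _ hc' (by omega) (by omega), hf₁ _ hc2 hc']

/-! ## Emulated arithmetic -/

/-- Reduced operations other than `sub`, computed at word size `W` and reduced modulo `2 ^ ws`
(`ws ≤ W`), give the result at word size `ws`. [folklore] -/
theorem BinOp.eval_mod_of_isReduced {ws : ℕ} (hws : ws ≤ W) :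
    ∀ (o : BinOp), o.IsReduced = true → o ≠ .sub → ∀ x y : ℕ,
      (o.eval W x y) % 2 ^ ws = o.eval ws x y
  | .add, _, _, x, y => Nat.mod_mod_of_dvd _ (Nat.pow_dvd_pow 2 hws)
  | .mul, _, _, x, y => Nat.mod_mod_of_dvd _ (Nat.pow_dvd_pow 2 hws)
  | .bor, _, _, x, y => Nat.mod_mod_of_dvd _ (Nat.pow_dvd_pow 2 hws)
  | .bxor, _, _, x, y => Nat.mod_mod_of_dvd _ (Nat.pow_dvd_pow 2 hws)
  | .shl, _, _, x, y => Nat.mod_mod_of_dvd _ (Nat.pow_dvd_pow 2 hws)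
  | .sub, _, h, _, _ => absurd rfl h
  | .div, h, _, _, _ => by simp [BinOp.IsReduced] at h
  | .mod, h, _, _, _ => by simp [BinOp.IsReduced] at h
  | .band, h, _, _, _ => by simp [BinOp.IsReduced] at h
  | .shr, h, _, _, _ => by simp [BinOp.IsReduced] at h
  | .lt, h, _, _, _ => by simp [BinOp.IsReduced] at h
  | .eq, h, _, _, _ => by simp [BinOp.IsReduced] at h

/-- Word-size independent operations. [folklore] -/
theorem BinOp.eval_eq_of_not_isReduced (ws : ℕ) :
    ∀ (o : BinOp), o.IsReduced = false → ∀ x y : ℕ, o.eval W x y = o.eval ws x y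
  | .div, _, _, _ => rfl
  | .mod, _, _, _ => rfl
  | .band, _, _, _ => rfl
  | .shr, _, _, _ => rfl
  | .lt, _, _, _ => rfl
  | .eq, _, _, _ => rfl
  | .add, h, _, _ => by simp [BinOp.IsReduced] at h
  | .sub, h, _, _ => by simp [BinOp.IsReduced] at h
  | .mul, h, _, _ => by simp [BinOp.IsReduced] at h
  | .bor, h, _, _ => by simp [BinOp.IsReduced] at h
  | .bxor, h, _, _ => by simp [BinOp.IsReduced] at h
  | .shl, h, _, _ => by simp [BinOp.IsReduced] at h

/-- The arithmetic of the emulated subtraction: with `P ∣ N`, `0 < P ≤ N`,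
`(((x + P) % N + N - y % P) % N) % P = (x + P - y % P) % P`. [folklore] -/
theorem emulated_sub_mod {P N : ℕ} (hPN : P ∣ N) (hP : 0 < P) (hle : P ≤ N) (x y : ℕ) :
    (((x + P) % N + N - y % P) % N) % P = (x + P - y % P) % P := by
  have hN : 0 < N := lt_of_lt_of_le hP hle
  have hy : y % P < P := Nat.mod_lt _ hP
  rw [Nat.mod_mod_of_dvd _ hPN]
  -- both sides are congruent to `x - y % P` modulo `P`; write them as `_ + multiple of P`
  have h1 : (x + P) % N + N - y % P = (x + P) % N + (N - P) + (P - y % P) := by omega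
  have h2 : x + P - y % P = x + (P - y % P) := by omega
  rw [h1, h2, Nat.add_mod, Nat.add_mod ((x + P) % N), Nat.mod_mod_of_dvd _ hPN]
  obtain ⟨m, hm⟩ := hPN
  have hm1 : 1 ≤ m := by
    rcases Nat.eq_zero_or_pos m with rfl | h
    · simp at hm; omega
    · exact h
  have hNP : N - P = P * (m - 1) := by
    rw [hm, Nat.mul_sub_one, Nat.sub_eq_iff_eq_add (Nat.le_mul_of_pos_right _ hm1)]
    have : P ≤ P * m := Nat.le_mul_of_pos_right _ hm1
    omega
  rw [hNP, Nat.mul_mod_right, Nat.add_zero, Nat.mod_mod, Nat.add_mod x, Nat.add_mod (x % P)]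
  simp [Nat.add_mod]

/-- **Semantics of `earith`.** With `EnvHolds` (so `rP` holds `2 ^ ws`, `ws ≤ W`), whatever the
contents of the two temporaries, `earith o` puts `o.eval ws (mem t1) (mem t2)` into `t1`,
changing only `t1` and `t2`. [folklore] -/
theorem execOps_earith (hOK : EnvOK L E W) {mem : ℕ → ℕ} (henv : EnvHolds L E mem) (o : BinOp) :
    (execOps W mem (earith L o)) L.t1 = o.eval E.ws (mem L.t1) (mem L.t2) ∧
      ∀ c, c ≠ L.t1 → c ≠ L.t2 → (execOps W mem (earith L o)) c = mem c := by
  obtain ⟨-, -, -, hP⟩ := henv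
  have h12 := hOK.t1_ne_t2
  have hrP := hOK.rP_ne
  have hws := hOK.ws_le
  by_cases hsub : o = .sub
  · subst hsub
    have hexec : execOps W mem (earith L .sub) =
        execOps W mem [(.mod, .dir L.t2, .dir L.t2, .dir L.rP), (.add, .dir L.t1, .dir L.t1, .dir L.rP),
          (.sub, .dir L.t1, .dir L.t1, .dir L.t2), (.mod, .dir L.t1, .dir L.t1, .dir L.rP)] := rfl
    rw [hexec]
    simp only [execOps_cons, execOps_nil, execOp_dir, Operand.read_dir, BinOp.eval]
    -- normalise the chain of updates
    simp only [Function.update_self, Function.update_of_ne h12, Function.update_of_ne h12.symm,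
      Function.update_of_ne hrP.1, Function.update_of_ne hrP.2.1, hP]
    refine ⟨?_, fun c hc1 hc2 => ?_⟩
    · rw [Nat.mod_eq_of_lt (a := mem L.t2 % 2 ^ E.ws)
        (lt_of_lt_of_le (Nat.mod_lt _ (Nat.two_pow_pos _)) (Nat.pow_le_pow_right (by norm_num) hws))]
      exact emulated_sub_mod hOK.pow_dvd (Nat.two_pow_pos _) (Nat.pow_le_pow_right (by norm_num) hws)
        _ _
    · simp only [Function.update_of_ne hc1, Function.update_of_ne hc2]
  · by_cases hred : o.IsReduced = true
    · have hexec : execOps W mem (earith L o) =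
          execOps W mem [(o, .dir L.t1, .dir L.t1, .dir L.t2), (.mod, .dir L.t1, .dir L.t1, .dir L.rP)] := by
        cases o <;> simp_all [earith, BinOp.IsReduced]
      rw [hexec]
      simp only [execOps_cons, execOps_nil, execOp_dir, Operand.read_dir]
      simp only [Function.update_self, Function.update_of_ne hrP.1, hP]
      refine ⟨?_, fun c hc1 _ => ?_⟩
      · exact BinOp.eval_mod_of_isReduced hws o hred hsub _ _
      · simp only [Function.update_of_ne hc1]
    · have hred' : o.IsReduced = false := by simpa using hred
      have hexec : execOps W mem (earith L o) =
          execOps W mem [(o, .dir L.t1, .dir L.t1, .dir L.t2)] := by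
        cases o <;> simp_all [earith, BinOp.IsReduced]
      rw [hexec]
      simp only [execOps_cons, execOps_nil, execOp_dir, Operand.read_dir, Function.update_self]
      exact ⟨BinOp.eval_eq_of_not_isReduced E.ws o hred' _ _, fun c hc1 _ => by
        simp only [Function.update_of_ne hc1]⟩

/-- The constants of `earith` are `t1, t2, rP`. [folklore] -/
theorem earith_maxConst (L : Layout) (o : BinOp) {V : ℕ} (ht1 : L.t1 ≤ V) (ht2 : L.t2 ≤ V)
    (hrP : L.rP ≤ V) : ∀ s ∈ earith L o, s.maxConst ≤ V := by
  intro s hs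
  by_cases hsub : o = .sub
  · subst hsub
    simp only [earith, List.mem_cons, List.mem_nil_iff, or_false] at hs
    rcases hs with rfl | rfl | rfl | rfl <;>
      simp only [OpSpec.maxConst, OpSpec.toInstr, Instr.maxConst, Operand.const_dir, max_le_iff] <;>
      omega
  · have : s = (o, .dir L.t1, .dir L.t1, .dir L.t2) ∨ s = (.mod, .dir L.t1, .dir L.t1, .dir L.rP) := by
      cases o <;> simp_all [earith, BinOp.IsReduced]
    rcases this with rfl | rfl <;>
      simp only [OpSpec.maxConst, OpSpec.toInstr, Instr.maxConst, Operand.const_dir, max_le_iff] <;>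
      omega

/-- `earith` preserves the target invariant (given `t1, t2, rP ≤ VT`). [folklore] -/
theorem TInv.earith (hOK : EnvOK L E W) (hVT : VT + 1 = 2 ^ W) {mem : ℕ → ℕ} (hI : TInv L E VT mem)
    (o : BinOp) (h1 : 1 ≤ VT) (ht1V : L.t1 ≤ VT) (ht2V : L.t2 ≤ VT) (hrPV : L.rP ≤ VT) :
    TInv L E VT (execOps W mem (earith L o)) := by
  obtain ⟨-, hf⟩ := execOps_earith hOK hI.env o
  have ht1 := hOK.t1_lt; have ht2 := hOK.t2_lt
  have hrB := hOK.rB_ne; have hrS := hOK.rS_ne; have hrG := hOK.rGen_ne; have hrP := hOK.rP_ne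
  have hfit := hOK.fitB
  obtain ⟨⟨e1, e2, e3, e4⟩, hst, hm⟩ := hI
  exact ⟨⟨by rw [hf _ hrB.1 hrB.2.1, e1], by rw [hf _ hrS.1 hrS.2.1, e2], by rw [hf _ hrG.1 hrG.2.1, e3],
    by rw [hf _ hrP.1 hrP.2.1, e4]⟩, hst.of_low_frame fun c hc => hf _ (by omega) (by omega),
    execOps_memLE (by omega) h1 _ hm (earith_maxConst L o ht1V ht2V hrPV)⟩

/-- **Semantics of `eop`.** The emulation of `op o dst x y` on an emulated memory agreeing with
the `V`-bounded source memory `dmem`: afterwards the emulated memory agrees with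
`dst.write dmem (o.eval ws (x.read dmem) (y.read dmem))` — the source semantics of the
instruction — the target invariant is preserved, and only the temporaries and region cells
change. [folklore] -/
theorem execOps_eop (hOK : EnvOK L E W) (hVT : VT + 1 = 2 ^ W) {mem dmem : ℕ → ℕ}
    (hI : TInv L E VT mem) (hag : Agree E mem dmem) {V : ℕ} (hdm : MemLE V dmem) (hVQ : V < E.Q)
    (hVVT : V ≤ VT) (h1 : 1 ≤ VT) (hregV : ∀ r ∈ L.regs, r ≤ VT) (o : BinOp) (dst x y : Operand)
    (hdst : dst.const ≤ V) (hx : x.const ≤ V) (hy : y.const ≤ V) :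
    TInv L E VT (execOps W mem (eop L o dst x y)) ∧
      Agree E (execOps W mem (eop L o dst x y))
        (dst.write dmem (o.eval E.ws (x.read dmem) (y.read dmem))) ∧
      ∀ c, ¬ Foot L E c → (execOps W mem (eop L o dst x y)) c = mem c := by
  have ht1 := hOK.t1_lt; have ht2 := hOK.t2_lt; have hta := hOK.ta_lt
  have h12 := hOK.t1_ne_t2; have h1a := hOK.t1_ne_ta; have h2a := hOK.t2_ne_ta
  have hrB := hOK.rB_ne; have hrS := hOK.rS_ne; have hrG := hOK.rGen_ne; have hrP := hOK.rP_ne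
  have ht1V : L.t1 ≤ VT := hregV _ (by simp [Layout.regs])
  have ht2V : L.t2 ≤ VT := hregV _ (by simp [Layout.regs])
  have hrPV : L.rP ≤ VT := hregV _ (by simp [Layout.regs])
  -- 1. read x into t1
  obtain ⟨hI₁, hv₁, hag₁, hf₁⟩ := execOps_erd hOK hVT hI hag hdm hVQ hVVT h1 x hx
    ⟨h1a, hrB.1.symm, hrS.1.symm, hrG.1.symm⟩ hrP.1.symm ht1 ht1V
  set m₁ := execOps W mem (erd L x L.t1)
  -- 2. read y into t2
  obtain ⟨hI₂, hv₂, hag₂, hf₂⟩ := execOps_erd hOK hVT hI₁ hag₁ hdm hVQ hVVT h1 y hy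
    ⟨h2a, hrB.2.1.symm, hrS.2.1.symm, hrG.2.1.symm⟩ hrP.2.1.symm ht2 ht2V
  set m₂ := execOps W m₁ (erd L y L.t2)
  have ht1₂ : m₂ L.t1 = x.read dmem := by rw [hf₂ _ h12 h1a, hv₁]
  -- 3. arithmetic
  obtain ⟨hv₃, hf₃⟩ := execOps_earith hOK hI₂.env o
  have hI₃ := hI₂.earith hOK hVT o h1 ht1V ht2V hrPV
  set m₃ := execOps W m₂ (earith L o)
  have hag₃ : Agree E m₃ dmem := hag₂.of_low_frame fun c hc => hf₃ _ (by omega) (by omega)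
  have ht1₃ : m₃ L.t1 = o.eval E.ws (x.read dmem) (y.read dmem) := by rw [hv₃, ht1₂, hv₂]
  -- 4. write
  obtain ⟨hI₄, hag₄, -, hf₄⟩ := execOps_ewr hOK hVT hI₃ hag₃ hdm hVQ hVVT h1 ht1V ht2V dst hdst
  have hexec : execOps W mem (eop L o dst x y) = execOps W m₃ (ewr L dst) := by
    simp only [eop, execOps_append, m₃, m₂, m₁]
  rw [hexec]
  refine ⟨hI₄, by rw [ht1₃] at hag₄; exact hag₄, fun c hc => ?_⟩
  simp only [Foot, not_or] at hc
  obtain ⟨hc1, hc2, hca, hcB, hcS⟩ := hc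
  rw [hf₄ _ hc2 hca hcB hcS, hf₃ _ hc1 hc2, hf₂ _ hc2 hca, hf₁ _ hc1 hca]

end operands

/-! ## The block compiler -/

section compiler

variable (L : Layout) (qlen : ℕ)

/-- The length of the block emulating an instruction (independent of positions): `op` — the
length of `eop`; `jmp`, `rand`, `halt` — one jump; `jz` — an emulated read and a jump; `query` —
the caller-supplied length `qlen`. [folklore] -/
def blkLen : Instr → ℕ
  | .op o dst x y => (eop L o dst x y).length
  | .jmp _ => 1
  | .jz x _ => (erd L x L.t1).length + 1
  | .rand _ => 1
  | .halt => 1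
  | .query _ _ _ => qlen

variable (M : Program) (base : ℕ)

/-- The length of the block at source position `j` (`0` past the end). [folklore] -/
def blkLenAt (j : ℕ) : ℕ :=
  match M[j]? with
  | some I => blkLen L qlen I
  | none => 0

/-- The start of the block of source position `i` in the compiled code placed at `base`; for
`i ≥ |M|` this is the exit position (right after the compiled code). [folklore] -/
def bstart (i : ℕ) : ℕ :=
  base + ((List.range (min i M.length)).map (blkLenAt L qlen M)).sum

/-- The exit position of the compiled code. [folklore] -/
def exitPos : ℕ :=
  bstart L qlen M base M.length

variable (qb : ℕ → Operand → Operand → Operand → List Instr)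

/-- The block emulating the instruction at source position `i`: `op` ↦ `eop`; `jmp t` ↦ a jump
to the block start of `t`; `jz x t` ↦ emulated read of `x` and a conditional jump; `halt` and
`rand` (absent from deterministic sources) ↦ a jump to the exit; `query` ↦ the caller's block
`qb` (given its own position and the operands). [folklore] -/
def blkAt (i : ℕ) : List Instr :=
  match M[i]? with
  | some (.op o dst x y) => (eop L o dst x y).map OpSpec.toInstr
  | some (.jmp t) => [.jmp (bstart L qlen M base t)]
  | some (.jz x t) => (erd L x L.t1).map OpSpec.toInstr ++ [.jz (.dir L.t1) (bstart L qlen M base t)]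
  | some (.rand _) => [.jmp (exitPos L qlen M base)]
  | some .halt => [.jmp (exitPos L qlen M base)]
  | some (.query qa ql aa) => qb (bstart L qlen M base i) qa ql aa
  | none => []

/-- **The compiled code**: the blocks of all source positions, in order. [folklore] -/
def compile : List Instr :=
  ((List.range M.length).map (blkAt L qlen M base qb)).flatten

variable {L qlen M base qb}

/-- Block `0` starts at `base`. [folklore] -/
theorem bstart_zero : bstart L qlen M base 0 = base := by simp [bstart]

/-- The start of block `i + 1` is the start of block `i` plus its length. [folklore] -/
theorem bstart_succ {i : ℕ} (hi : i < M.length) :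
    bstart L qlen M base (i + 1) = bstart L qlen M base i + blkLenAt L qlen M i := by
  simp only [bstart, Nat.min_eq_left hi, Nat.min_eq_left hi.le, List.range_succ, List.map_append,
    List.map_cons, List.map_nil, List.sum_append, List.sum_cons, List.sum_nil, Nat.add_zero,
    Nat.add_assoc]

/-- Block starts past the end of the program are the exit position. [folklore] -/
theorem bstart_of_le {i : ℕ} (hi : M.length ≤ i) :
    bstart L qlen M base i = exitPos L qlen M base := by
  simp only [bstart, exitPos, Nat.min_eq_right hi, Nat.min_self]

/-- Block starts are at least `base`. [folklore] -/
theorem base_le_bstart (i : ℕ) : base ≤ bstart L qlen M base i := Nat.le_add_right _ _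

/-- Block starts are monotone. [folklore] -/
theorem bstart_mono {i j : ℕ} (hij : i ≤ j) : bstart L qlen M base i ≤ bstart L qlen M base j := by
  simp only [bstart]
  have : min i M.length ≤ min j M.length := min_le_min_right _ hij
  obtain ⟨k, hk⟩ := Nat.exists_eq_add_of_le this
  rw [hk, List.range_add, List.map_append, List.sum_append]
  omega

/-- Block starts are at most the exit position. [folklore] -/
theorem bstart_le_exitPos (i : ℕ) : bstart L qlen M base i ≤ exitPos L qlen M base := by
  rcases Nat.lt_or_ge i M.length with h | h
  · exact bstart_mono h.le
  · rw [bstart_of_le h]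

/-- The block of position `i` has length `blkLenAt i`, provided query blocks have length `qlen`. [folklore] -/
theorem length_blkAt (hqb : ∀ pos qa ql aa, (qb pos qa ql aa).length = qlen) (i : ℕ) :
    (blkAt L qlen M base qb i).length = blkLenAt L qlen M i := by
  simp only [blkAt, blkLenAt]
  cases M[i]? with
  | none => rfl
  | some I => cases I <;> simp [blkLen, hqb]

/-- The compiled code has length `exitPos - base`. [folklore] -/
theorem length_compile (hqb : ∀ pos qa ql aa, (qb pos qa ql aa).length = qlen) :
    (compile L qlen M base qb).length + base = exitPos L qlen M base := by
  simp only [compile, List.length_flatten, List.map_map, exitPos, bstart, Nat.min_self]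
  rw [Nat.add_comm]
  congr 2
  exact List.map_congr_left fun i _ => length_blkAt hqb i

/-- **Code placement.** If the compiled code sits at `base`, the block of source position
`i < |M|` sits at `bstart i`. [folklore] -/
theorem codeAt_blkAt {P : Program} (hqb : ∀ pos qa ql aa, (qb pos qa ql aa).length = qlen)
    (hcode : CodeAt P base (compile L qlen M base qb)) {i : ℕ} (hi : i < M.length) :
    CodeAt P (bstart L qlen M base i) (blkAt L qlen M base qb i) := by
  obtain ⟨r, hr⟩ := Nat.exists_eq_add_of_lt hi
  have hsplit : ∃ rest, compile L qlen M base qb =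
      ((List.range i).map (blkAt L qlen M base qb)).flatten ++ (blkAt L qlen M base qb i ++ rest) := by
    refine ⟨((List.range r).map fun j => blkAt L qlen M base qb (i + (j + 1))).flatten, ?_⟩
    simp only [compile]
    rw [hr, show i + r + 1 = i + (r + 1) by omega, List.range_add, List.map_append,
      List.flatten_append, List.range_succ_eq_map]
    simp only [List.map_cons, List.map_map, List.flatten_cons, Nat.add_zero]
    rfl
  obtain ⟨rest, hsplit⟩ := hsplit
  rw [hsplit] at hcode
  have h1 := (codeAt_append_iff.1 (codeAt_append_iff.1 hcode).2).1
  have hlen : ((List.range i).map (blkAt L qlen M base qb)).flatten.length =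
      ((List.range (min i M.length)).map (blkLenAt L qlen M)).sum := by
    rw [Nat.min_eq_left hi.le, List.length_flatten, List.map_map]
    congr 1
    exact List.map_congr_left fun j _ => length_blkAt hqb j
  simpa only [bstart, hlen] using h1

end compiler

/-! ## The simulation relation and the one-step theorem -/

section simulation

variable {L : Layout} {E : Env} {W VT : ℕ} {M : Program} {base qlen : ℕ}
  {qb : ℕ → Operand → Operand → Operand → List Instr} {P : Program}

/-- **The simulation relation.** The target program counter is at the block start of the source
program counter (the exit if the source has halted or left the program), the emulated memory
agrees with the source memory below `Q`, and the target invariant holds. [folklore] -/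
structure ERel (L : Layout) (E : Env) (VT : ℕ) (M : Program) (base qlen : ℕ) (d e : Cfg) : Prop where
  /-- Program counters correspond. -/
  pc : e.pc = some (bstart L qlen M base (d.pc.getD M.length))
  /-- The emulated memory is the source memory. -/
  agree : Agree E e.mem d.mem
  /-- The target invariant. -/
  inv : TInv L E VT e.mem

/-- The number of target steps emulating one source step is at most `38`
(`eop` with two indirect reads, `sub`, and an indirect write). [folklore] -/
def cstep : ℕ := 38

/-- An emulated read at an address is `6` instructions. [folklore] -/
theorem length_erdAt (L : Layout) (src : Operand) (T : ℕ) : (erdAt L src T).length = 6 := rfl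
/-- An emulated write at an address is `4` instructions. [folklore] -/
theorem length_ewrAt (L : Layout) (dst : Operand) (Tv : ℕ) : (ewrAt L dst Tv).length = 4 := rfl

/-- An emulated operand read is at most `12` instructions. [folklore] -/
theorem length_erd_le (L : Layout) (x : Operand) (T : ℕ) : (erd L x T).length ≤ 12 := by
  cases x <;> simp [erd, length_erdAt]

/-- An emulated operand write is at most `10` instructions. [folklore] -/
theorem length_ewr_le (L : Layout) (dst : Operand) : (ewr L dst).length ≤ 10 := by
  cases dst <;> simp [ewr, length_erdAt, length_ewrAt]

/-- Emulated arithmetic is at most `4` instructions. [folklore] -/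
theorem length_earith_le (L : Layout) (o : BinOp) : (earith L o).length ≤ 4 := by
  cases o <;> simp [earith, BinOp.IsReduced]

/-- An emulated three-address instruction is at most `cstep` instructions. [folklore] -/
theorem length_eop_le (L : Layout) (o : BinOp) (dst x y : Operand) :
    (eop L o dst x y).length ≤ cstep := by
  simp only [eop, List.length_append, cstep]
  have := length_erd_le L x L.t1; have := length_erd_le L y L.t2
  have := length_earith_le L o; have := length_ewr_le L dst
  omega

/-- Every non-query block is at most `cstep` instructions. [folklore] -/
theorem blkLen_le_of_ne_query (L : Layout) (qlen : ℕ) :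
    ∀ I : Instr, I.isQuery = false → blkLen L qlen I ≤ cstep
  | .op o dst x y, _ => length_eop_le L o dst x y
  | .jmp _, _ => by simp [blkLen, cstep]
  | .jz x _, _ => by have := length_erd_le L x L.t1; simp [blkLen, cstep]; omega
  | .rand _, _ => by simp [blkLen, cstep]
  | .halt, _ => by simp [blkLen, cstep]
  | .query _ _ _, h => by simp [Instr.isQuery] at h

/-- The constants of `erd`. [folklore] -/
theorem erd_maxConst (L : Layout) (x : Operand) (T : ℕ) {V : ℕ} (hx : x.const ≤ V) (hT : T ≤ V)
    (hregs : ∀ r ∈ L.regs, r ≤ V) (h1 : 1 ≤ V) : ∀ s ∈ erd L x T, s.maxConst ≤ V := by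
  have hta : L.ta ≤ V := hregs _ (by simp [Layout.regs])
  have hrB : L.rB ≤ V := hregs _ (by simp [Layout.regs])
  have hrS : L.rS ≤ V := hregs _ (by simp [Layout.regs])
  have hrG : L.rGen ≤ V := hregs _ (by simp [Layout.regs])
  cases x with
  | imm c =>
    intro s hs
    simp only [erd, List.mem_singleton] at hs
    subst hs
    simp only [Operand.const_imm] at hx
    simp only [OpSpec.maxConst, OpSpec.toInstr, Instr.maxConst, Operand.const_dir, Operand.const_imm,
      max_le_iff]
    omega
  | dir a => exact erdAt_maxConst L _ T (by simpa using hx) hT hta hrB hrS hrG h1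
  | ind a =>
    intro s hs
    simp only [erd, List.mem_append] at hs
    rcases hs with hs | hs
    · exact erdAt_maxConst L _ T (by simpa using hx) hT hta hrB hrS hrG h1 s hs
    · exact erdAt_maxConst L _ T (by simpa using hT) hT hta hrB hrS hrG h1 s hs

/-- **One emulated step.** Let the compiled code of the deterministic source `M` sit at `base`
in `P`, with query blocks of length `qlen`; let the source configuration `d` (memory
`V`-bounded, `maxConst M ≤ V < Q`, `2 ^ ws - 1 ≤ V ≤ VT`) be related to the target configuration
`e`, and let the source step from `d` not be a `query`. Then the target, from `e`, reaches in at
most `cstep` steps a configuration related to the source successor `d'`, with the same coins and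
query log, having changed only temporaries and region cells. [folklore] -/
theorem emu_step (hOK : EnvOK L E W) (hVT : VT + 1 = 2 ^ W) (h1 : 1 ≤ VT)
    (hregV : ∀ r ∈ L.regs, r ≤ VT) (hqb : ∀ pos qa ql aa, (qb pos qa ql aa).length = qlen)
    (hcode : CodeAt P base (compile L qlen M base qb)) (hdet : M.IsDeterministic) {V : ℕ}
    (hMV : Program.maxConst M ≤ V) (hVQ : V < E.Q) (hVVT : V ≤ VT)
    {O : List ℕ → List ℕ} {ρ : ℕ → ℕ} (O' : List ℕ → List ℕ) (ρ' : ℕ → ℕ)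
    {d d' e : Cfg} (hrel : ERel L E VT M base qlen d e) (hdm : MemLE V d.mem)
    (hstep : step M E.ws O ρ d = some d')
    (hnq : ∀ i qa ql aa, d.pc = some i → M[i]? ≠ some (.query qa ql aa)) :
    ∃ n, n ≤ cstep ∧ ∃ e', run P W O' ρ' n e = some e' ∧ ERel L E VT M base qlen d' e' ∧
      e'.coinPos = e.coinPos ∧ e'.queries = e.queries ∧
      ∀ c, ¬ Foot L E c → e'.mem c = e.mem c := by
  obtain ⟨hpc, hag, hI⟩ := hrel
  have ht1 := hOK.t1_lt; have hta := hOK.ta_lt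
  have h1a := hOK.t1_ne_ta
  have hrB := hOK.rB_ne; have hrS := hOK.rS_ne; have hrG := hOK.rGen_ne; have hrP := hOK.rP_ne
  have ht1V : L.t1 ≤ VT := hregV _ (by simp [Layout.regs])
  cases hdpc : d.pc with
  | none => rw [step_of_pc_eq_none hdpc] at hstep; exact absurd hstep (by simp)
  | some i =>
    rw [hdpc] at hpc
    simp only [Option.getD_some] at hpc
    cases hMi : M[i]? with
    | none =>
      -- the source leaves the program: it halts; the target is already at the exit
      rw [step_of_getElem?_eq_none hdpc hMi] at hstep
      simp only [Option.some.injEq] at hstep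
      subst hstep
      refine ⟨0, Nat.zero_le _, e, run_zero _ _ _ _ e, ⟨?_, hag, hI⟩, rfl, rfl, fun _ _ => rfl⟩
      simp only [Option.getD_none, hpc]
      rw [bstart_of_le (Nat.le_of_not_lt fun h => by simp [List.getElem?_eq_getElem h] at hMi)]
      rfl
    | some I =>
      have hi : i < M.length := (List.getElem?_eq_some_iff.1 hMi).1
      have hblk := codeAt_blkAt hqb hcode hi
      have hbs := bstart_succ (L := L) (qlen := qlen) (base := base) hi
      simp only [blkAt, blkLenAt, hMi] at hblk hbs
      have hIc : I.maxConst ≤ V := le_trans (Instr.maxConst_le_of_getElem? hMi) hMV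
      cases I with
      | halt =>
        rw [step_halt hdpc hMi] at hstep
        simp only [Option.some.injEq] at hstep
        subst hstep
        refine ⟨1, by simp [cstep], { e with pc := some (exitPos L qlen M base) }, ?_,
          ⟨by simp [exitPos], hag, hI⟩, rfl, rfl, fun _ _ => rfl⟩
        rw [run_one, step_jmp hpc hblk.getElem?_zero]
      | jmp t =>
        rw [step_jmp hdpc hMi] at hstep
        simp only [Option.some.injEq] at hstep
        subst hstep
        refine ⟨1, by simp [cstep], { e with pc := some (bstart L qlen M base t) }, ?_,
          ⟨by simp, hag, hI⟩, rfl, rfl, fun _ _ => rfl⟩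
        rw [run_one, step_jmp hpc hblk.getElem?_zero]
      | rand dst =>
        exact absurd (hdet _ (List.mem_of_getElem? hMi)) (by simp [Instr.isRand])
      | query qa ql aa => exact absurd hMi (hnq i qa ql aa hdpc)
      | jz x t =>
        rw [step_jz hdpc hMi] at hstep
        simp only [Option.some.injEq] at hstep
        subst hstep
        simp only [Instr.maxConst] at hIc
        obtain ⟨hcode₁, hcode₂⟩ := codeAt_append_iff.1 hblk
        -- the emulated read
        obtain ⟨hI₁, hv₁, hag₁, hf₁⟩ := execOps_erd hOK hVT hI hag hdm hVQ hVVT h1 x hIc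
          ⟨h1a, hrB.1.symm, hrS.1.symm, hrG.1.symm⟩ hrP.1.symm ht1 ht1V
        have hrun₁ := run_ops (P := P) (w := W) (O := O') (ρ := ρ') (erd L x L.t1) hcode₁ hpc
        let e₁ : Cfg := ⟨some (bstart L qlen M base i + (erd L x L.t1).length),
          execOps W e.mem (erd L x L.t1), e.coinPos, e.queries⟩
        have hjz : P[bstart L qlen M base i + (erd L x L.t1).length]? =
            some (.jz (.dir L.t1) (bstart L qlen M base t)) := by
          simpa using hcode₂.getElem?_zero
        refine ⟨(erd L x L.t1).length + 1, by have := length_erd_le L x L.t1; simp [cstep]; omega,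
          ?_⟩
        by_cases hz : x.read d.mem = 0
        · refine ⟨⟨some (bstart L qlen M base t), execOps W e.mem (erd L x L.t1), e.coinPos, e.queries⟩,
            ?_, ⟨by simp [hz], hag₁, hI₁⟩, rfl, rfl, fun c hc => ?_⟩
          · rw [run_add_of_run _ _ _ _ hrun₁]
            rw [run_one, step_jz_zero (c := e₁) rfl hjz (by simp [e₁, hv₁, hz])]
          · simp only [Foot, not_or] at hc
            exact hf₁ c hc.1 hc.2.2.1
        · refine ⟨⟨some (bstart L qlen M base (i + 1)), execOps W e.mem (erd L x L.t1), e.coinPos,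
            e.queries⟩, ?_, ⟨by simp [hz], hag₁, hI₁⟩, rfl, rfl, fun c hc => ?_⟩
          · rw [run_add_of_run _ _ _ _ hrun₁]
            rw [run_one, step_jz_ne (c := e₁) rfl hjz (by simp [e₁, hv₁, hz])]
            simp only [hbs, Nat.add_assoc]
            rfl
          · simp only [Foot, not_or] at hc
            exact hf₁ c hc.1 hc.2.2.1
      | op o dst x y =>
        rw [step_op hdpc hMi] at hstep
        simp only [Option.some.injEq] at hstep
        subst hstep
        simp only [Instr.maxConst, max_le_iff] at hIc
        obtain ⟨hI₁, hag₁, hf₁⟩ := execOps_eop hOK hVT hI hag hdm hVQ hVVT h1 hregV o dst x y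
          hIc.1 hIc.2.1 hIc.2.2
        have hrun₁ := run_ops (P := P) (w := W) (O := O') (ρ := ρ') (eop L o dst x y) hblk hpc
        refine ⟨(eop L o dst x y).length, length_eop_le L o dst x y, _, hrun₁,
          ⟨?_, hag₁, hI₁⟩, rfl, rfl, hf₁⟩
        simp only [Option.getD_some, hbs]
        rfl

/-- **Emulated runs.** For an oracle-free deterministic source, `n` source steps from a related
pair are emulated by at most `cstep * n` target steps, ending in a related pair; coins and query
log of the target are unchanged and only temporaries and region cells change. [folklore] -/
theorem emu_run (hOK : EnvOK L E W) (hVT : VT + 1 = 2 ^ W) (h1 : 1 ≤ VT)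
    (hregV : ∀ r ∈ L.regs, r ≤ VT) (hqb : ∀ pos qa ql aa, (qb pos qa ql aa).length = qlen)
    (hcode : CodeAt P base (compile L qlen M base qb)) (hdet : M.IsDeterministic)
    (hof : M.IsOracleFree) {V : ℕ} (hMV : Program.maxConst M ≤ V) (hVQ : V < E.Q) (hVVT : V ≤ VT)
    (hwsV : 2 ^ E.ws - 1 ≤ V) (h1V : 1 ≤ V) {ρ : ℕ → ℕ} (O' : List ℕ → List ℕ) (ρ' : ℕ → ℕ)
    {d₀ e₀ : Cfg} (hrel : ERel L E VT M base qlen d₀ e₀) (hdm : MemLE V d₀.mem) :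
    ∀ (n : ℕ) {dn : Cfg}, run M E.ws noOracle ρ n d₀ = some dn →
      ∃ m, m ≤ cstep * n ∧ ∃ en, run P W O' ρ' m e₀ = some en ∧ ERel L E VT M base qlen dn en ∧
        en.coinPos = e₀.coinPos ∧ en.queries = e₀.queries ∧
        ∀ c, ¬ Foot L E c → en.mem c = e₀.mem c
  | 0, dn, h => by
      simp only [run_zero, Option.some.injEq] at h
      subst h
      exact ⟨0, le_rfl, e₀, rfl, hrel, rfl, rfl, fun _ _ => rfl⟩
  | n + 1, dn, h => by
      rw [run_add, Option.bind_eq_some_iff] at h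
      obtain ⟨dm, hdm', hlast⟩ := h
      rw [run_one] at hlast
      obtain ⟨m, hm, em, hrun, hrelm, hco, hqu, hfr⟩ := emu_run hOK hVT h1 hregV hqb hcode hdet hof
        hMV hVQ hVVT hwsV h1V O' ρ' hrel hdm n hdm'
      have hmemm : MemLE V dm.mem := iterate_step_memLE hwsV h1V hMV n hdm hdm'
      have hnq : ∀ i qa ql aa, dm.pc = some i → M[i]? ≠ some (.query qa ql aa) := by
        intro i qa ql aa _ hq
        exact absurd (hof _ (List.mem_of_getElem? hq)) (by simp [Instr.isQuery])
      obtain ⟨m', hm', e', hrun', hrel', hco', hqu', hfr'⟩ :=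
        emu_step hOK hVT h1 hregV hqb hcode hdet hMV hVQ hVVT O' ρ' hrelm hmemm hlast hnq
      refine ⟨m + m', by rw [Nat.mul_succ]; omega, e', run_add_of_run _ _ _ _ hrun hrun', hrel',
        by rw [hco', hco], by rw [hqu', hqu], fun c hc => ?_⟩
      rw [hfr' c hc, hfr c hc]

/-- **Emulating a halting run.** If the oracle-free deterministic source, started in `d₀`
related to `e₀`, reaches the halted configuration `dh` after `n` steps
(`run … n d₀ = some dh`, `dh.pc = none`), then the target reaches, within `cstep * n` steps, a
configuration at the exit position whose emulated memory is `dh.mem` (target invariant, coins,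
query log and all cells off the footprint preserved). [folklore] -/
theorem emu_halt (hOK : EnvOK L E W) (hVT : VT + 1 = 2 ^ W) (h1 : 1 ≤ VT)
    (hregV : ∀ r ∈ L.regs, r ≤ VT) (hqb : ∀ pos qa ql aa, (qb pos qa ql aa).length = qlen)
    (hcode : CodeAt P base (compile L qlen M base qb)) (hdet : M.IsDeterministic)
    (hof : M.IsOracleFree) {V : ℕ} (hMV : Program.maxConst M ≤ V) (hVQ : V < E.Q) (hVVT : V ≤ VT)
    (hwsV : 2 ^ E.ws - 1 ≤ V) (h1V : 1 ≤ V) {ρ : ℕ → ℕ} (O' : List ℕ → List ℕ) (ρ' : ℕ → ℕ)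
    {d₀ e₀ : Cfg} (hrel : ERel L E VT M base qlen d₀ e₀) (hdm : MemLE V d₀.mem)
    {n : ℕ} {dh : Cfg} (hrun : run M E.ws noOracle ρ n d₀ = some dh) (hhalt : dh.pc = none) :
    ∃ m, m ≤ cstep * n ∧ ∃ eh, run P W O' ρ' m e₀ = some eh ∧
      eh.pc = some (exitPos L qlen M base) ∧ Agree E eh.mem dh.mem ∧ TInv L E VT eh.mem ∧
      eh.coinPos = e₀.coinPos ∧ eh.queries = e₀.queries ∧
      ∀ c, ¬ Foot L E c → eh.mem c = e₀.mem c := by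
  obtain ⟨m, hm, eh, hrunT, ⟨hpc, hag, hI⟩, hco, hqu, hfr⟩ :=
    emu_run hOK hVT h1 hregV hqb hcode hdet hof hMV hVQ hVVT hwsV h1V O' ρ' hrel hdm n hrun
  refine ⟨m, hm, eh, hrunT, ?_, hag, hI, hco, hqu, hfr⟩
  rw [hpc, hhalt, Option.getD_none, exitPos]

end simulation

end Literature.Computability.Cryptography.WordRAM
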